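import Summits.AtomisticToContinuum.HydrodynamicLimit.Theorems.JParityClosureLocalSecondLawLedgerDefs
import Literature.Analysis.FluidPDE.HardSphereFlowJointMeasurable
import Literature.MathematicalPhysics.KineticTheory.HardSphereEulerProofs
import Mathlib.Probability.Kernel.RadonNikodym
import Mathlib.Analysis.SpecialFunctions.JapaneseBracket
import HarnessLib

/-!
# Exchange-pairing tools for the crux `LocalSecondLaw` (stmt-AtomisticToContinuum-13081), line
# `contact-asymmetry-information`: existence of the slice-wise one-particle density

Helper file (`--supports stmt-AtomisticToContinuum-13081`) for stub S `stub_exchangePairing` (and the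
consumers M, K4, B′ of the same line), whose ensemble objects start with a ONE-PARTICLE DENSITY of a law
`ν` on the `(N+1)`-sphere phase space transported by a hard-sphere flow `Φ` on `𝕋³`: a jointly measurable
`f ≥ 0` on `ℝ × 𝕋³ × ℝ³` such that, for EVERY time `s` and every bounded measurable test function `G`,
`E_ν[(N+1)⁻¹ ∑ᵢ G(Φₛ z i)] = ∫ G(y) f(s, y) dy` (the body of the line's `IsOneParticleDensity`, verbatim,
at every `s ∈ ℝ`, hence on every `[0, τ]`).

What is proved.

* `exists_oneParticleDensity_of_ac` / `exists_oneParticleDensity` (registered form) — for every hard-sphere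
  flow `Φ` (the hypothesis structure `HardSphereFlow`
  on `𝕋³`, any diameter) and every FINITE law `ν` absolutely continuous with respect to the Liouville
  measure, such an `f` exists.  Proof: `Φₛ` preserves the Liouville measure (`HardSphereFlow.measurePreserving`),
  so the expected empirical one-particle measure at time `s` is absolutely continuous with respect to
  `dx dv` for every `s` (`Measure.quasiMeasurePreserving_eval`); the good-set modification of the flow is
  jointly measurable in `(s, z)` (`HardSphereFlow.measurable_flow_prod_torus`: right-continuity of good
  orbits), so `s ↦` (marginal at `s`) is a finite KERNEL, and Mathlib's kernel Radon–Nikodym derivative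
  (`ProbabilityTheory.Kernel.rnDeriv`, Doob's jointly measurable version; `𝕋³ × ℝ³` is standard Borel)
  against the finite reference measure `(1 + ‖v‖)⁻⁴ dx dv` gives the jointly measurable density.
* `exists_oneParticleDensity_condLaw` — the instance used by the line: the conditioned local Gibbs law
  `P_N(· | S) = P_N(S)⁻¹ · P_N|_S` of a cell `S` of positive mass (`σ ≤ 1/2`).

References: C. Cercignani, R. Illner, M. Pulvirenti, *The Mathematical Theory of Dilute Gases* (1994),
§4.2–4.3 (one-particle marginals of laws transported by the hard-sphere flow); O. Kallenberg,
*Random Measures, Theory and Applications* (2017), Thm 1.28 (measurable Radon–Nikodym versions for kernels).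
-/

noncomputable section

open MeasureTheory Set Filter Function ProbabilityTheory
open scoped ENNReal Classical

namespace Summit.AtomisticToContinuum.HydrodynamicLimit.Theorems.ExchangePairing

open Literature.Analysis.FluidPDE Literature.MathematicalPhysics.KineticTheory
open Summit.AtomisticToContinuum.HydrodynamicLimit.Theorems.LocalSecondLawLedger

variable {σ : ℝ} {N : ℕ}

/-! ### A finite reference measure on `𝕋³ × ℝ³` equivalent to Lebesgue measure -/

/-- The reference weight `(1 + ‖v‖)⁻⁴` on the one-particle phase space (integrable on `ℝ³`, positive,
finite). [folklore] -/
def refWeight (y : T3 × V3) : ℝ≥0∞ :=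
  ENNReal.ofReal ((1 + ‖y.2‖) ^ (-(4 : ℝ)))

/-- The reference weight is measurable. [folklore] -/
theorem measurable_refWeight : Measurable refWeight := by
  unfold refWeight
  fun_prop

/-- The reference weight is positive. [folklore] -/
theorem refWeight_ne_zero (y : T3 × V3) : refWeight y ≠ 0 := by
  unfold refWeight
  rw [Ne, ENNReal.ofReal_eq_zero, not_le]
  exact Real.rpow_pos_of_pos (by positivity) _

/-- The reference weight is finite. [folklore] -/
theorem refWeight_ne_top (y : T3 × V3) : refWeight y ≠ ∞ := ENNReal.ofReal_ne_top

/-- The finite reference measure `(1 + ‖v‖)⁻⁴ dx dv` on `𝕋³ × ℝ³`. [folklore] -/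
def refMeasure : Measure (T3 × V3) := volume.withDensity refWeight

/-- The reference measure is finite (`vol 𝕋³ < ∞` and `∫ (1 + ‖v‖)⁻⁴ dv < ∞` since `4 > 3 = dim`).
[folklore] -/
instance isFiniteMeasure_refMeasure : IsFiniteMeasure refMeasure := by
  refine ⟨?_⟩
  rw [refMeasure, withDensity_apply _ MeasurableSet.univ, Measure.restrict_univ,
    MeasureTheory.Measure.volume_eq_prod T3 V3, lintegral_prod _ measurable_refWeight.aemeasurable]
  have hinner : ∀ x : T3, ∫⁻ v : V3, refWeight (x, v) =
      ∫⁻ v : V3, ENNReal.ofReal ((1 + ‖v‖) ^ (-(4 : ℝ))) := fun x => rfl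
  simp_rw [hinner, lintegral_const]
  refine ENNReal.mul_lt_top ?_ (measure_lt_top _ _)
  refine finite_integral_one_add_norm ?_
  rw [finrank_euclideanSpace_fin]
  norm_num

/-- Lebesgue measure is absolutely continuous with respect to the reference measure (the weight is
positive). [folklore] -/
theorem volume_absolutelyContinuous_refMeasure : (volume : Measure (T3 × V3)) ≪ refMeasure :=
  withDensity_absolutelyContinuous' measurable_refWeight.aemeasurable
    (Eventually.of_forall refWeight_ne_zero)

/-! ### The good-set modification of the flow and the one-particle marginal kernel -/

/-- The flow modified to the identity off its good set (a Liouville-null modification, jointly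
measurable in `(s, z)`). [folklore] -/
def goodFlow (Φ : Flow σ N) (s : ℝ) (z : Phase N) : Phase N :=
  if z ∈ Φ.good then Φ.flow s z else z

/-- On the good set the modified flow is the flow. [folklore] -/
theorem goodFlow_eq_of_mem (Φ : Flow σ N) {z : Phase N} (hz : z ∈ Φ.good) (s : ℝ) :
    goodFlow Φ s z = Φ.flow s z := by
  simp [goodFlow, hz]

/-- The modified flow is JOINTLY measurable in `(s, z)` (right-continuity of good orbits,
`HardSphereFlow.measurable_flow_prod_torus`). [folklore] -/
theorem measurable_goodFlow_uncurry (Φ : Flow σ N) :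
    Measurable fun p : ℝ × Phase N => goodFlow Φ p.1 p.2 := by
  classical
  have hS : MeasurableSet {p : ℝ × Phase N | p.2 ∈ Φ.good} := measurable_snd Φ.measurableSet_good
  have h1 : Measurable fun p : {p : ℝ × Phase N | p.2 ∈ Φ.good} => Φ.flow p.1.1 p.1.2 := by
    have hq : Measurable fun p : {p : ℝ × Phase N | p.2 ∈ Φ.good} =>
        ((⟨p.1.2, p.2⟩ : Φ.good), p.1.1) :=
      (measurable_subtype_coe.snd.subtype_mk).prodMk measurable_subtype_coe.fst
    exact (HardSphereFlow.measurable_flow_prod_torus Φ).comp hq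
  have h2 : Measurable fun p : ({p : ℝ × Phase N | p.2 ∈ Φ.good}ᶜ : Set (ℝ × Phase N)) => p.1.2 :=
    measurable_subtype_coe.snd
  have h := Measurable.dite h1 h2 hS
  convert h using 1
  funext p
  simp only [goodFlow, Set.mem_setOf_eq, dite_eq_ite]

/-- Each time slice of the modified flow is measurable. [folklore] -/
theorem measurable_goodFlow (Φ : Flow σ N) (s : ℝ) : Measurable (goodFlow Φ s) := by
  have h : Measurable fun z : Phase N => ((s, z) : ℝ × Phase N) := measurable_const.prodMk measurable_id
  exact (measurable_goodFlow_uncurry Φ).comp h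

/-- Each one-particle coordinate of the modified flow is measurable. [folklore] -/
theorem measurable_goodFlow_apply (Φ : Flow σ N) (s : ℝ) (i : Fin (N + 1)) :
    Measurable fun z : Phase N => goodFlow Φ s z i :=
  (measurable_pi_apply i).comp (measurable_goodFlow Φ s)

/-- The expected empirical one-particle measure of the law `ν` at time `s` (through the modified flow):
`A ↦ (N+1)⁻¹ ∑ᵢ ν{z | Φₛ z i ∈ A}`. [folklore] -/
def oneMarginal (Φ : Flow σ N) (ν : Measure (Phase N)) (s : ℝ) : Measure (T3 × V3) :=
  ((N : ℝ≥0∞) + 1)⁻¹ • ∑ i : Fin (N + 1), ν.map (fun z => goodFlow Φ s z i)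

/-- Evaluation of the one-particle marginal on a measurable set. [folklore] -/
theorem oneMarginal_apply (Φ : Flow σ N) (ν : Measure (Phase N)) (s : ℝ) {A : Set (T3 × V3)}
    (hA : MeasurableSet A) :
    oneMarginal Φ ν s A = ((N : ℝ≥0∞) + 1)⁻¹ * ∑ i : Fin (N + 1), ν ((fun z => goodFlow Φ s z i) ⁻¹' A) := by
  rw [oneMarginal, Measure.smul_apply, smul_eq_mul, Measure.coe_finsetSum, Finset.sum_apply]
  congr 1
  refine Finset.sum_congr rfl fun i _ => ?_
  exact Measure.map_apply (measurable_goodFlow_apply Φ s i) hA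

/-- `s ↦` (one-particle marginal at `s`) is measurable for the Giry σ-algebra (joint measurability of the
modified flow and Fubini measurability of sections). [folklore] -/
theorem measurable_oneMarginal (Φ : Flow σ N) (ν : Measure (Phase N)) [SFinite ν] :
    Measurable (oneMarginal Φ ν) := by
  refine Measure.measurable_of_measurable_coe _ fun A hA => ?_
  simp_rw [oneMarginal_apply Φ ν _ hA]
  refine Measurable.const_mul (Finset.measurable_sum _ fun i _ => ?_) _
  have hT : MeasurableSet {p : ℝ × Phase N | goodFlow Φ p.1 p.2 i ∈ A} :=
    ((measurable_pi_apply i).comp (measurable_goodFlow_uncurry Φ)) hA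
  exact measurable_measure_prodMk_left hT

/-- The one-particle marginal KERNEL `s ↦ (N+1)⁻¹ ∑ᵢ (z ↦ Φₛ z i)_* ν`. [folklore] -/
def marginalKernel (Φ : Flow σ N) (ν : Measure (Phase N)) [SFinite ν] : Kernel ℝ (T3 × V3) :=
  ⟨oneMarginal Φ ν, measurable_oneMarginal Φ ν⟩

/-- Unfolding lemma for the marginal kernel. [folklore] -/
theorem marginalKernel_apply (Φ : Flow σ N) (ν : Measure (Phase N)) [SFinite ν] (s : ℝ) :
    marginalKernel Φ ν s = oneMarginal Φ ν s := rfl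

/-- The marginal kernel of a finite law is a finite kernel (mass `≤ ν(univ)` at every time). [folklore] -/
instance isFiniteKernel_marginalKernel (Φ : Flow σ N) (ν : Measure (Phase N)) [IsFiniteMeasure ν] :
    IsFiniteKernel (marginalKernel Φ ν) := by
  refine ⟨⟨(N + 1 : ℝ≥0∞) * ν univ, ENNReal.mul_lt_top (by simp) (measure_lt_top _ _), fun s => ?_⟩⟩
  rw [marginalKernel_apply, oneMarginal_apply Φ ν s MeasurableSet.univ]
  simp only [preimage_univ, Finset.sum_const, Finset.card_univ, Fintype.card_fin, nsmul_eq_mul,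
    Nat.cast_add, Nat.cast_one]
  calc ((N : ℝ≥0∞) + 1)⁻¹ * ((N + 1 : ℝ≥0∞) * ν univ) ≤ 1 * ((N + 1 : ℝ≥0∞) * ν univ) := by
        gcongr
        exact ENNReal.inv_le_one.2 (by simp)
    _ = (N + 1 : ℝ≥0∞) * ν univ := one_mul _

/-- **Absolute continuity of the one-particle marginals at EVERY time**: for a law `ν ≪ Liouville`, the
expected empirical one-particle measure at time `s` is absolutely continuous with respect to `dx dv`
(`Φₛ` preserves the Liouville measure, which is dominated by the product Lebesgue measure, whose
coordinate projections are quasi-measure-preserving). [folklore] -/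
theorem oneMarginal_absolutelyContinuous (Φ : Flow σ N) (ν : Measure (Phase N))
    (hν : ν ≪ liouville (Torus.geometry (Fin 3)) (N + 1) (hsDiameter σ N)) (s : ℝ) :
    oneMarginal Φ ν s ≪ (volume : Measure (T3 × V3)) := by
  refine Measure.AbsolutelyContinuous.mk fun A hA hA0 => ?_
  rw [oneMarginal_apply Φ ν s hA]
  have hi : ∀ i : Fin (N + 1), ν ((fun z => goodFlow Φ s z i) ⁻¹' A) = 0 := by
    intro i
    -- the product Lebesgue measure of the cylinder over `A` vanishes
    have h1 : (volume : Measure (Phase N)) ((fun z : Phase N => z i) ⁻¹' A) = 0 := by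
      rw [MeasureTheory.volume_pi]
      exact (@Measure.quasiMeasurePreserving_eval (Fin (N + 1)) (fun _ => T3 × V3) _ _ (fun _ => volume)
        (fun _ => (inferInstance : SigmaFinite (volume : Measure (T3 × V3)))) i).preimage_null hA0
    -- hence its Liouville measure vanishes
    have h2 : liouville (Torus.geometry (Fin 3)) (N + 1) (hsDiameter σ N) ((fun z : Phase N => z i) ⁻¹' A) = 0 :=
      le_antisymm ((Measure.le_iff'.1 Measure.restrict_le_self _).trans h1.le) bot_le
    -- pull back along the measure-preserving time-`s` map
    have h3 : liouville (Torus.geometry (Fin 3)) (N + 1) (hsDiameter σ N)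
        ((Φ.flow s) ⁻¹' ((fun z : Phase N => z i) ⁻¹' A)) = 0 :=
      (Φ.measurePreserving s).quasiMeasurePreserving.preimage_null h2
    -- the modified flow differs from the flow only off the (null) good set
    have h4 : liouville (Torus.geometry (Fin 3)) (N + 1) (hsDiameter σ N)
        ((fun z => goodFlow Φ s z i) ⁻¹' A) = 0 := by
      refine measure_mono_null (fun z hz => ?_) (measure_union_null h3 Φ.measure_compl_good)
      by_cases hzg : z ∈ Φ.good
      · left
        simpa [goodFlow_eq_of_mem Φ hzg s] using hz
      · right
        exact hzg
    exact hν h4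
  simp [hi]

/-! ### Existence of the slice-wise one-particle density -/

/-- **Existence of a jointly measurable slice-wise one-particle density.**  For every hard-sphere flow `Φ`
of `N + 1` spheres on `𝕋³` and every finite law `ν` absolutely continuous with respect to the Liouville
measure there is `f : ℝ × 𝕋³ × ℝ³ → ℝ`, non-negative and (jointly) measurable, such that for EVERY time `s`
and every bounded measurable `G`,
`z ↦ (N+1)⁻¹ ∑ᵢ G(Φₛ z i)` is `ν`-integrable and `∫ (N+1)⁻¹ ∑ᵢ G(Φₛ z i) dν(z) = ∫ G(y) f(s, y) dy`
— the body of the line's `IsOneParticleDensity`, for all `s ∈ ℝ`. [folklore] -/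
theorem exists_oneParticleDensity_of_ac (Φ : Flow σ N) (ν : Measure (Phase N)) [IsFiniteMeasure ν]
    (hν : ν ≪ liouville (Torus.geometry (Fin 3)) (N + 1) (hsDiameter σ N)) :
    ∃ f : ℝ × T3 × V3 → ℝ, (∀ p, 0 ≤ f p) ∧ Measurable f ∧
      ∀ s : ℝ, ∀ G : T3 × V3 → ℝ, Measurable G → (∃ C : ℝ, ∀ y, |G y| ≤ C) →
        Integrable (fun z => (N + 1 : ℝ)⁻¹ * ∑ i : Fin (N + 1), G (Φ.flow s z i)) ν ∧
          ∫ z, ((N + 1 : ℝ)⁻¹ * ∑ i : Fin (N + 1), G (Φ.flow s z i)) ∂ν =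
            ∫ y : T3 × V3, G y * f (s, y) := by
  classical
  haveI : StandardBorelSpace (T3 × V3) := standardBorel_of_polish
  -- the jointly measurable density w.r.t. Lebesgue measure (kernel Radon–Nikodym against the reference)
  let F : ℝ × (T3 × V3) → ℝ≥0∞ := fun p =>
    refWeight p.2 * Kernel.rnDeriv (marginalKernel Φ ν) (Kernel.const ℝ refMeasure) p.1 p.2
  have hFm : Measurable F :=
    (measurable_refWeight.comp measurable_snd).mul
      (Kernel.measurable_rnDeriv (marginalKernel Φ ν) (Kernel.const ℝ refMeasure))
  refine ⟨fun p => (F p).toReal, fun p => ENNReal.toReal_nonneg, hFm.ennreal_toReal, ?_⟩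
  intro s G hG hGb
  obtain ⟨C, hC⟩ := hGb
  -- ν is carried by the good set
  have hgood : ∀ᵐ z ∂ν, z ∈ Φ.good := hν.ae_le Φ.ae_mem_good
  -- measurability of the summands
  have hmeas_i : ∀ i : Fin (N + 1), Measurable fun z : Phase N => G (Φ.flow s z i) := fun i =>
    hG.comp ((measurable_pi_apply i).comp (Φ.measurable_flow s))
  have hmeas : Measurable fun z : Phase N => (N + 1 : ℝ)⁻¹ * ∑ i : Fin (N + 1), G (Φ.flow s z i) :=
    measurable_const.mul (Finset.measurable_sum _ fun i _ => hmeas_i i)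
  have hbound : ∀ z : Phase N, ‖(N + 1 : ℝ)⁻¹ * ∑ i : Fin (N + 1), G (Φ.flow s z i)‖ ≤ C := by
    intro z
    rw [Real.norm_eq_abs, abs_mul, abs_inv]
    have hN : |(N + 1 : ℝ)| = N + 1 := abs_of_pos (by positivity)
    rw [hN]
    calc (N + 1 : ℝ)⁻¹ * |∑ i : Fin (N + 1), G (Φ.flow s z i)|
        ≤ (N + 1 : ℝ)⁻¹ * ∑ i : Fin (N + 1), |G (Φ.flow s z i)| := by
          gcongr
          exact Finset.abs_sum_le_sum_abs _ _
      _ ≤ (N + 1 : ℝ)⁻¹ * ∑ _i : Fin (N + 1), C := by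
          gcongr with i
          exact hC _
      _ = C := by
          rw [Finset.sum_const, Finset.card_univ, Fintype.card_fin, nsmul_eq_mul]
          push_cast
          field_simp
  have hint : Integrable (fun z => (N + 1 : ℝ)⁻¹ * ∑ i : Fin (N + 1), G (Φ.flow s z i)) ν :=
    Integrable.of_bound hmeas.aestronglyMeasurable C (Eventually.of_forall hbound)
  refine ⟨hint, ?_⟩
  -- Step 1: replace the flow by the modified flow (a.e. equal under ν)
  have hG_i : ∀ i : Fin (N + 1), Integrable (fun z : Phase N => G (goodFlow Φ s z i)) ν := fun i =>
    Integrable.of_bound ((hG.comp (measurable_goodFlow_apply Φ s i)).aestronglyMeasurable)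
      C (Eventually.of_forall fun z => by rw [Real.norm_eq_abs]; exact hC _)
  have step1 : ∫ z, ((N + 1 : ℝ)⁻¹ * ∑ i : Fin (N + 1), G (Φ.flow s z i)) ∂ν =
      (N + 1 : ℝ)⁻¹ * ∑ i : Fin (N + 1), ∫ z, G (goodFlow Φ s z i) ∂ν := by
    have hcongr : ∫ z, ((N + 1 : ℝ)⁻¹ * ∑ i : Fin (N + 1), G (Φ.flow s z i)) ∂ν =
        ∫ z, ((N + 1 : ℝ)⁻¹ * ∑ i : Fin (N + 1), G (goodFlow Φ s z i)) ∂ν := by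
      refine integral_congr_ae ?_
      filter_upwards [hgood] with z hz
      simp [goodFlow_eq_of_mem Φ hz s]
    rw [hcongr, integral_const_mul, integral_finsetSum _ fun i _ => hG_i i]
  -- Step 2: each term is an integral against the push-forward, and their normalised sum is `∫ G dκ s`
  have step2 : (N + 1 : ℝ)⁻¹ * ∑ i : Fin (N + 1), ∫ z, G (goodFlow Φ s z i) ∂ν =
      ∫ y, G y ∂(marginalKernel Φ ν s) := by
    have hscal : (((N : ℝ≥0∞) + 1)⁻¹).toReal = (N + 1 : ℝ)⁻¹ := by
      rw [ENNReal.toReal_inv, ENNReal.toReal_add (ENNReal.natCast_ne_top N) ENNReal.one_ne_top,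
        ENNReal.toReal_natCast, ENNReal.toReal_one]
    rw [marginalKernel_apply, oneMarginal, integral_smul_measure, integral_finsetSum_measure, hscal,
      smul_eq_mul]
    · congr 1
      refine Finset.sum_congr rfl fun i _ => ?_
      rw [integral_map (measurable_goodFlow_apply Φ s i).aemeasurable hG.aestronglyMeasurable]
    · intro i _
      exact Integrable.of_bound hG.aestronglyMeasurable C
        (Eventually.of_forall fun y => by rw [Real.norm_eq_abs]; exact hC _)
  -- Step 3: `κ s` has density `F (s, ·)` with respect to Lebesgue measure
  have hκac : (marginalKernel Φ ν) s ≪ (Kernel.const ℝ refMeasure) s := by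
    rw [Kernel.const_apply]
    exact (oneMarginal_absolutelyContinuous Φ ν hν s).trans volume_absolutelyContinuous_refMeasure
  have step3 : (marginalKernel Φ ν) s = (volume : Measure (T3 × V3)).withDensity fun y => F (s, y) := by
    have h := Kernel.withDensity_rnDeriv_eq (κ := marginalKernel Φ ν) (η := Kernel.const ℝ refMeasure) hκac
    rw [Kernel.withDensity_apply _
      (Kernel.measurable_rnDeriv (marginalKernel Φ ν) (Kernel.const ℝ refMeasure)),
      Kernel.const_apply] at h
    rw [← h]
    exact (withDensity_mul (volume : Measure (T3 × V3)) measurable_refWeight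
      (Kernel.measurable_rnDeriv_right (marginalKernel Φ ν) (Kernel.const ℝ refMeasure) s)).symm
  -- Step 4: integrate against the density
  have hFfin : ∀ᵐ y ∂(volume : Measure (T3 × V3)), F (s, y) < ∞ := by
    have h1 : ∀ᵐ y ∂((Kernel.const ℝ refMeasure) s),
        Kernel.rnDeriv (marginalKernel Φ ν) (Kernel.const ℝ refMeasure) s y < ∞ :=
      Kernel.rnDeriv_lt_top _ _
    rw [Kernel.const_apply] at h1
    filter_upwards [volume_absolutelyContinuous_refMeasure.ae_le h1] with y hy
    exact ENNReal.mul_lt_top (refWeight_ne_top y).lt_top hy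
  have hFs : Measurable fun y : T3 × V3 => F (s, y) := by
    have h : Measurable fun y : T3 × V3 => ((s, y) : ℝ × (T3 × V3)) := measurable_const.prodMk measurable_id
    exact hFm.comp h
  rw [step1, step2, step3, integral_withDensity_eq_integral_toReal_smul hFs hFfin]
  refine integral_congr_ae (Eventually.of_forall fun y => ?_)
  simp only [smul_eq_mul]
  ring

/-- **Registered form** (sub-goal `exists_oneParticleDensity` of stmt-AtomisticToContinuum-13081, all binders after the
colon, verbatim the registered signature): existence of a jointly measurable slice-wise one-particle density for
every finite law absolutely continuous with respect to the Liouville measure, under any hard-sphere flow on `𝕋³`.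
[folklore] -/
theorem exists_oneParticleDensity : ∀ {σ : ℝ} {N : ℕ} (Φ : Flow σ N) (ν : Measure (Phase N)) [IsFiniteMeasure ν], ν ≪ liouville (Torus.geometry (Fin 3)) (N + 1) (hsDiameter σ N) → ∃ f : ℝ × T3 × V3 → ℝ, (∀ p, 0 ≤ f p) ∧ Measurable f ∧ ∀ s : ℝ, ∀ G : T3 × V3 → ℝ, Measurable G → (∃ C : ℝ, ∀ y, |G y| ≤ C) → Integrable (fun z => (N + 1 : ℝ)⁻¹ * ∑ i : Fin (N + 1), G (Φ.flow s z i)) ν ∧ ∫ z, ((N + 1 : ℝ)⁻¹ * ∑ i : Fin (N + 1), G (Φ.flow s z i)) ∂ν = ∫ y : T3 × V3, G y * f (s, y) :=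
  fun Φ ν _ hν => exists_oneParticleDensity_of_ac Φ ν hν

/-- **The instance used by the line**: the conditioned local Gibbs law `P_N(· | S) = P_N(S)⁻¹ · P_N|_S` of
any cell `S` of positive mass has a jointly measurable slice-wise one-particle density (for `σ ≤ 1/2`,
when the local Gibbs law is a probability measure; the body of `IsOneParticleDensity τ (condLaw μ S) Φ f`
restricted to `s ∈ [0, τ]`). [folklore] -/
theorem exists_oneParticleDensity_condLaw {a₀ θ₀ : T3 → ℝ} {u₀ : T3 → V3} (ha : Continuous a₀)
    (hθ : Continuous θ₀) (hu : Continuous u₀) (ha0 : ∀ x, 0 < a₀ x) (hθ0 : ∀ x, 0 < θ₀ x)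
    {σ : ℝ} (hσ2 : σ ≤ 1 / 2) (N : ℕ) (Φ : Flow σ N) (S : Set (Phase N))
    (hS : localGibbsLaw σ a₀ u₀ θ₀ N Φ S ≠ 0) (τ : ℝ) :
    ∃ f : ℝ × T3 × V3 → ℝ, (∀ p, 0 ≤ f p) ∧ Measurable f ∧
      ∀ s ∈ Set.Icc (0 : ℝ) τ, ∀ G : T3 × V3 → ℝ, Measurable G → (∃ C : ℝ, ∀ y, |G y| ≤ C) →
        Integrable (fun z => (N + 1 : ℝ)⁻¹ * ∑ i : Fin (N + 1), G (Φ.flow s z i))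
            (((localGibbsLaw σ a₀ u₀ θ₀ N Φ) S)⁻¹ • (localGibbsLaw σ a₀ u₀ θ₀ N Φ).restrict S) ∧
          ∫ z, ((N + 1 : ℝ)⁻¹ * ∑ i : Fin (N + 1), G (Φ.flow s z i))
              ∂(((localGibbsLaw σ a₀ u₀ θ₀ N Φ) S)⁻¹ • (localGibbsLaw σ a₀ u₀ θ₀ N Φ).restrict S) =
            ∫ y : T3 × V3, G y * f (s, y) := by
  set μ := localGibbsLaw σ a₀ u₀ θ₀ N Φ with hμ
  haveI : IsProbabilityMeasure μ := isProbabilityMeasure_localGibbsLaw ha hθ hu ha0 hθ0 hσ2 N Φ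
  set ν : Measure (Phase N) := (μ S)⁻¹ • μ.restrict S with hν
  have hfin : (μ S)⁻¹ ≠ ∞ := ENNReal.inv_ne_top.2 hS
  haveI : IsFiniteMeasure ν := by
    refine ⟨?_⟩
    rw [hν, Measure.smul_apply, smul_eq_mul]
    exact ENNReal.mul_lt_top hfin.lt_top (measure_lt_top _ _)
  have hνμ : ν ≪ μ := by
    rw [hν]
    exact (Measure.absolutelyContinuous_of_le Measure.restrict_le_self).smul_left _
  have hμL : μ ≪ liouville (Torus.geometry (Fin 3)) (N + 1) (hsDiameter σ N) := by
    rw [hμ, localGibbsLaw_eq]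
    exact localGibbsMeasure_absolutelyContinuous σ a₀ u₀ θ₀ N Φ
  obtain ⟨f, hf0, hfm, hf⟩ := exists_oneParticleDensity_of_ac Φ ν (hνμ.trans hμL)
  exact ⟨f, hf0, hfm, fun s _ G hG hGb => hf s G hG hGb⟩

end Summit.AtomisticToContinuum.HydrodynamicLimit.Theorems.ExchangePairing

end
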